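import Mathlib
import Literature.NumberTheory.NumberFields.InertiaGeneratesGalois
import HarnessLib

/-!
# Base change and sub-extensions of abelian extensions unramified at all places

Topic `NumberTheory/NumberFields`.  Theorem-only file (no definition, no named fact), unconditional.

Two pieces of bookkeeping on ramification that the class-field-theoretic divisibility theorems for
class numbers (`ClassNumberDivisibilityInExtensions.lean`: Washington Thm. 4.10 / Prop. 4.11,
Lang Ch. 3 §4) need, for extensions of number fields unramified at every finite prime and at the
infinite places:

* **Sub-extensions** (`§1`): if `B/k` is unramified at all places and `A ↪ B` over `k`, then `A/k` is
  unramified at all places (`e(𝔔|v) = e(𝔓|v) e(𝔔|𝔓)`; restriction of places).  Applied to an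
  isomorphism `A ≃ₐ[k] B` this is the transport of "unramified at all places" to an isomorphic copy.
* **Base change** (`§2`, Neukirch II (7.2) globalised; the step "`KH/K` is unramified abelian, with
  `Gal(KH/K) ↪ Gal(H/F)`" of Lang Ch. 3 §4, Lemma to Thm. 4.3 and of Washington's proof of
  Prop. 4.11): inside a field `E` let `K₁, L₁` be intermediate fields over `F` with `K₁ L₁ = E`
  (`K₁ ⊔ L₁ = ⊤`), `K₁/F` finite abelian.  Then `E/L₁` is abelian with `Gal(E/L₁) ↪ Gal(K₁/F)`
  (Mathlib `restrictRestrictAlgEquivMapHom_injective`), `[E:L₁] ∣ [K₁:F]` with equality when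
  `K₁ ∩ L₁ = F`; and if `K₁/F` is unramified at the infinite places, resp. at every finite prime, so
  is `E/L₁`: a complex conjugation of `E/L₁` (resp. an element of an inertia group of `E/L₁`)
  restricts to a complex conjugation (resp. an inertia element) of `K₁/F`, which is trivial, and the
  restriction is injective; `#I(𝔓) = e(𝔓 | L₁)` (`card_inertia_eq_ramificationIdx`).

## References

* J. Neukirch, *Algebraic Number Theory* (1999), Ch. II §7 Prop. (7.2); Ch. I §9. [NeukirchANT1999]
* S. Lang, *Cyclotomic Fields I and II*, GTM 121 (1990), Ch. 3 §4, Lemma to Thm. 4.3. [Lang1990]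
* L. C. Washington, *Introduction to Cyclotomic Fields*, 2nd ed. (1997), Thm. 4.10, Prop. 4.11. [Washington1997]
-/

noncomputable section

open NumberField InfinitePlace IsDedekindDomain ComplexEmbedding
open scoped IsMulCommutative

namespace Literature.NumberTheory.NumberFields

/-! ### §1. Sub-extensions of extensions unramified at all places -/

section SubExtension

variable {k A B : Type*} [Field k] [Field A] [Field B] [Algebra k A] [Algebra k B]

/-- **A sub-extension of an extension unramified at the infinite places is unramified at the
infinite places**: if `B/k` is algebraic and unramified at the infinite places and `A` embeds into
`B` over `k`, then `A/k` is unramified at the infinite places (every infinite place of `A` extends to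
`B`; Mathlib `IsUnramified.comap`).  With `A ≃ₐ[k] B` this transports the property to isomorphic
copies. [cite: NeukirchANT1999, Ch. III §1 (infinite primes)] [folklore] -/
theorem isUnramifiedAtInfinitePlaces_of_algHom [Algebra.IsAlgebraic k B]
    [IsUnramifiedAtInfinitePlaces k B] (f : A →ₐ[k] B) : IsUnramifiedAtInfinitePlaces k A := by
  letI : Algebra A B := f.toRingHom.toAlgebra
  haveI : IsScalarTower k A B := IsScalarTower.of_algebraMap_eq fun x => (f.commutes x).symm
  haveI : Algebra.IsAlgebraic A B := Algebra.IsAlgebraic.tower_top (K := k) A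
  refine ⟨fun w => ?_⟩
  obtain ⟨w', hw'⟩ := InfinitePlace.comap_surjective (k := A) (K := B) w
  rw [← hw']
  exact (IsUnramifiedAtInfinitePlaces.isUnramified (k := k) w').comap A

/-- **A sub-extension of an extension unramified at every finite prime is unramified at every finite
prime**: for number fields `k`, `A`, `B` with `A ↪ B` over `k`, if every finite prime `v` of `k` is
unramified in `B`, then every `v` is unramified in `A`: a prime `𝔓 ∣ v` of `A` lies under a prime
`𝔔` of `B` and `e(𝔔|v) = e(𝔓|v) · e(𝔔|𝔓)` (Mathlib `Ideal.ramificationIdx_tower`).  With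
`A ≃ₐ[k] B` this transports the property to isomorphic copies.
[cite: NeukirchANT1999, Ch. II §7 Prop. (7.2)–(7.3)] [folklore] -/
theorem forall_isUnramifiedIn_of_algHom [NumberField k] [NumberField A] [NumberField B]
    (f : A →ₐ[k] B)
    (hB : ∀ v : HeightOneSpectrum (𝓞 k), Algebra.IsUnramifiedIn (𝓞 B) v.asIdeal) :
    ∀ v : HeightOneSpectrum (𝓞 k), Algebra.IsUnramifiedIn (𝓞 A) v.asIdeal := by
  classical
  letI : Algebra A B := f.toRingHom.toAlgebra
  haveI : IsScalarTower k A B := IsScalarTower.of_algebraMap_eq fun x => (f.commutes x).symm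
  intro v P hP hPv
  haveI := hP
  have hP0 : P ≠ ⊥ := by
    intro h0
    apply v.ne_bot
    rw [hPv.over, h0, Ideal.under_def, Ideal.comap_bot_of_injective _
      (FaithfulSMul.algebraMap_injective (𝓞 k) (𝓞 A))]
  haveI : P.IsMaximal := hP.isMaximal hP0
  obtain ⟨Q, hQmax, hQP⟩ := Ideal.exists_maximal_ideal_liesOver_of_isIntegral (S := 𝓞 B) P
  haveI := hQP
  haveI : Q.LiesOver v.asIdeal := Ideal.LiesOver.trans Q P v.asIdeal
  haveI : Algebra.IsUnramifiedAt (𝓞 k) Q := hB v Q hQmax.isPrime inferInstance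
  have htower : Q.ramificationIdx (𝓞 k) = P.ramificationIdx (𝓞 k) * Q.ramificationIdx (𝓞 A) :=
    Ideal.ramificationIdx_tower P Q
  rw [Ideal.ramificationIdx_eq_one Q (𝓞 k)] at htower
  exact (Ideal.ramificationIdx_eq_one_iff).mp (Nat.eq_one_of_mul_eq_one_right htower.symm)

end SubExtension

/-! ### §2. Base change: the compositum `E = K₁ L₁` over `L₁` -/

section Compositum

variable {F E : Type*} [Field F] [Field E] [Algebra F E] (K₁ L₁ : IntermediateField F E)

/-- **Base change of an abelian extension is abelian**: if `K₁/F` is finite abelian and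
`E = K₁ L₁`, then `E/L₁` is abelian (Galois by Mathlib `IsGalois.sup_right`; the restriction
`Gal(E/L₁) → Gal(K₁/F)` is an injective homomorphism, `restrictRestrictAlgEquivMapHom_injective`).
[cite: Lang1990, Ch. 3 §4, Lemma to Thm. 4.3] [folklore] -/
theorem isAbelianGalois_right_of_sup_eq_top [IsAbelianGalois F K₁] [FiniteDimensional F K₁]
    (h : K₁ ⊔ L₁ = ⊤) : IsAbelianGalois L₁ E := by
  haveI : IsGalois L₁ E := IsGalois.sup_right K₁ L₁ h
  exact
    { is_comm.comm := fun x y =>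
        IntermediateField.restrictRestrictAlgEquivMapHom_injective K₁ L₁ h
          (by rw [map_mul, map_mul, mul_comm]) }

/-- **`[K₁ L₁ : L₁] ∣ [K₁ : F]`** for `K₁/F` finite Galois (`Gal(E/L₁) ↪ Gal(K₁/F)`).
[cite: Lang1990, Ch. 3 §4, Lemma to Thm. 4.3] [folklore] -/
theorem finrank_right_dvd_of_sup_eq_top [IsGalois F K₁] [FiniteDimensional F E]
    (h : K₁ ⊔ L₁ = ⊤) : Module.finrank L₁ E ∣ Module.finrank F K₁ := by
  haveI : IsGalois L₁ E := IsGalois.sup_right K₁ L₁ h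
  haveI : FiniteDimensional L₁ E := Module.Finite.of_restrictScalars_finite F L₁ E
  rw [← IsGalois.card_aut_eq_finrank, ← IsGalois.card_aut_eq_finrank]
  exact Subgroup.card_dvd_of_injective _
    (IntermediateField.restrictRestrictAlgEquivMapHom_injective K₁ L₁ h)

/-- **`[K₁ L₁ : L₁] = [K₁ : F]` when moreover `K₁ ∩ L₁ = F`** (linear disjointness of a Galois
extension, Mathlib `IntermediateField.LinearDisjoint.of_inf_eq_bot`).
[cite: Lang1990, Ch. 3 §4, Lemma to Thm. 4.3] [folklore] -/
theorem finrank_right_eq_of_sup_eq_top_of_inf_eq_bot [IsGalois F K₁] [FiniteDimensional F E]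
    (h : K₁ ⊔ L₁ = ⊤) (h' : K₁ ⊓ L₁ = ⊥) : Module.finrank L₁ E = Module.finrank F K₁ :=
  (IntermediateField.LinearDisjoint.of_inf_eq_bot h').finrank_right_eq_finrank h

/-- **Base change of an extension unramified at the infinite places** (the archimedean part of
Neukirch II (7.2), globally): if `K₁/F` is finite Galois, unramified at the infinite places, and
`E = K₁ L₁`, then `E/L₁` is unramified at the infinite places.  A complex conjugation `σ` of `E/L₁`
at a ramified place (Mathlib `exists_isConj_of_isRamified`) restricts to a complex conjugation of
`K₁/F`, which is trivial (`IsConj.isUnramified_mk_iff`); the restriction being injective, `σ = 1`,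
i.e. the place is real. [cite: NeukirchANT1999, Ch. II §7 Prop. (7.2)] [folklore] -/
theorem isUnramifiedAtInfinitePlaces_right_of_sup_eq_top [IsGalois F K₁] [FiniteDimensional F E]
    [IsUnramifiedAtInfinitePlaces F K₁] (h : K₁ ⊔ L₁ = ⊤) :
    IsUnramifiedAtInfinitePlaces L₁ E := by
  haveI : IsGalois L₁ E := IsGalois.sup_right K₁ L₁ h
  refine ⟨fun w => ?_⟩
  by_contra hw
  rw [← InfinitePlace.mk_embedding w] at hw
  obtain ⟨σ, hσ⟩ := InfinitePlace.exists_isConj_of_isRamified hw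
  set τ := IntermediateField.restrictRestrictAlgEquivMapHom F K₁ L₁ E σ with hτdef
  -- `τ` is a complex conjugation of `K₁/F` at the place below `w`
  have hτ : IsConj (w.embedding.comp (algebraMap K₁ E)) τ := by
    ext x
    change conjugate (w.embedding.comp (algebraMap K₁ E)) x = w.embedding (((τ x : K₁) : E))
    rw [hτdef, IntermediateField.restrictRestrictAlgEquivMapHom_apply, hσ.eq]
    rfl
  have h1 : τ = 1 :=
    hτ.isUnramified_mk_iff.mp (IsUnramifiedAtInfinitePlaces.isUnramified (k := F) _)
  have hσ1 : σ = 1 :=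
    IntermediateField.restrictRestrictAlgEquivMapHom_injective K₁ L₁ h (by rw [← hτdef, h1, map_one])
  rw [hσ1, isConj_one_iff] at hσ
  exact hw ((isReal_mk_iff.mpr hσ).isUnramified L₁)

/-- **Base change of an extension unramified at every finite prime** (Neukirch II (7.2), globally,
for Galois `K₁/F`): if `F ⊆ E` are number fields, `K₁/F` is Galois and unramified at every finite
prime of `F`, and `E = K₁ L₁`, then `E/L₁` is unramified at every finite prime of `L₁`.  For a prime
`𝔓` of `E`, an element `σ` of the inertia group `I(𝔓) ≤ Gal(E/L₁)` restricts to an element of the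
inertia group of `𝔓 ∩ K₁` in `Gal(K₁/F)`, which is trivial as `#I(𝔓 ∩ K₁) = e(𝔓 ∩ K₁ | F) = 1`
(`card_inertia_eq_ramificationIdx`); the restriction being injective, `I(𝔓) = 1`, so
`e(𝔓 | L₁) = #I(𝔓) = 1`. [cite: NeukirchANT1999, Ch. II §7 Prop. (7.2)] [folklore] -/
theorem isUnramifiedIn_right_of_sup_eq_top [NumberField F] [NumberField E] [IsGalois F K₁]
    (hunr : ∀ v : HeightOneSpectrum (𝓞 F), Algebra.IsUnramifiedIn (𝓞 K₁) v.asIdeal)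
    (h : K₁ ⊔ L₁ = ⊤) :
    ∀ w : HeightOneSpectrum (𝓞 L₁), Algebra.IsUnramifiedIn (𝓞 E) w.asIdeal := by
  classical
  haveI : FiniteDimensional F E := Module.Finite.of_restrictScalars_finite ℚ F E
  haveI : IsGalois L₁ E := IsGalois.sup_right K₁ L₁ h
  haveI : NumberField K₁ := NumberField.of_module_finite F K₁
  haveI : NumberField L₁ := NumberField.of_module_finite F L₁
  intro w P hP hPw
  haveI := hP
  have hP0 : P ≠ ⊥ := by
    intro h0
    apply w.ne_bot
    rw [hPw.over, h0, Ideal.under_def, Ideal.comap_bot_of_injective _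
      (FaithfulSMul.algebraMap_injective (𝓞 L₁) (𝓞 E))]
  haveI : P.IsMaximal := hP.isMaximal hP0
  haveI : (P.under (𝓞 K₁)).IsMaximal := Ideal.IsMaximal.under (𝓞 K₁) P
  haveI : (P.under (𝓞 F)).IsMaximal := Ideal.IsMaximal.under (𝓞 F) P
  have hv0 : P.under (𝓞 F) ≠ ⊥ := mt Ideal.eq_bot_of_comap_eq_bot hP0
  -- the inertia group of `𝔓 ∩ K₁` in `Gal(K₁/F)` is trivial
  have hIK : (P.under (𝓞 K₁)).inertia (K₁ ≃ₐ[F] K₁) = ⊥ := by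
    apply Subgroup.eq_bot_of_card_eq
    rw [card_inertia_eq_ramificationIdx K₁ (K₁ ≃ₐ[F] K₁) F (P.under (𝓞 K₁))]
    let v : HeightOneSpectrum (𝓞 F) := ⟨P.under (𝓞 F), inferInstance, hv0⟩
    haveI : Algebra.IsUnramifiedAt (𝓞 F) (P.under (𝓞 K₁)) :=
      hunr v (P.under (𝓞 K₁)) inferInstance ⟨(Ideal.under_under (B := 𝓞 K₁) P).symm⟩
    exact Ideal.ramificationIdx_eq_one _ _
  -- hence the inertia group of `𝔓` in `Gal(E/L₁)` is trivial
  have hI : P.inertia (E ≃ₐ[L₁] E) = ⊥ := by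
    rw [eq_bot_iff]
    intro σ hσ
    rw [Subgroup.mem_bot]
    apply IntermediateField.restrictRestrictAlgEquivMapHom_injective K₁ L₁ h
    rw [map_one]
    set τ := IntermediateField.restrictRestrictAlgEquivMapHom F K₁ L₁ E σ with hτdef
    have hτ : τ ∈ (P.under (𝓞 K₁)).inertia (K₁ ≃ₐ[F] K₁) := by
      intro y
      change τ • y - y ∈ Ideal.comap (algebraMap (𝓞 K₁) (𝓞 E)) P
      rw [Ideal.mem_comap, map_sub]
      have hy : algebraMap (𝓞 K₁) (𝓞 E) (τ • y) = σ • algebraMap (𝓞 K₁) (𝓞 E) y := by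
        apply RingOfIntegers.ext
        change ((τ • (y : K₁) : K₁) : E) = σ • (((y : K₁) : E))
        rw [AlgEquiv.smul_def, AlgEquiv.smul_def, hτdef,
          IntermediateField.restrictRestrictAlgEquivMapHom_apply]
      rw [hy]
      exact hσ _
    rwa [hIK, Subgroup.mem_bot] at hτ
  have he : P.ramificationIdx (𝓞 L₁) = 1 := by
    rw [← card_inertia_eq_ramificationIdx E (E ≃ₐ[L₁] E) L₁ P, hI, Subgroup.card_bot]
  exact (Ideal.ramificationIdx_eq_one_iff).mp he

end Compositum

end Literature.NumberTheory.NumberFields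

end
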